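import Summits.HodgeConjecture.HodgeConjecture.Cruxes.BlochSeedDiscOne.SeedCheckerSplitBlockCFree
import Summits.HodgeConjecture.HodgeConjecture.Cruxes.BlochSeedDiscOne.RBDoorChainSheafCruxRescale

/-!
line stmt-HodgeConjecture-18881 Cruxes/BlochSeedDiscOne/Lines/birth.lean 814a6a70c14e831a stub_rung_pad4_seedAt

# SeedCheckerSplitBlockSheafBridge — v42.2, THE ONE-LINE BRIDGE (director-hodge R19.862 (C′)): v42.1's `SplitBlock.Rung2aSheafUpToScale`
composes BY NAME to `…Theses.EightfoldTwistedSheafSeeds.SheafSeedGaussSq` (hsemireg-c5c8-1 g55, 2026-08-31; TYPING-SPEC addendum for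
`Cruxes/SheafSeedGaussSq/Lines/sheafdoor.lean`, whose one writer is the cruxplan-30548-sheafdoor lineage — this file registers NO stub and
touches NO skeleton)

Additive over v42.1 `SeedCheckerSplitBlockCFree` 1bcdc3c1de7a79a0 (c5c8-1 g54) and `RBDoorChainSheafCruxRescale` 2a9d47ece519595b (sheaf8-1 g9):
nothing in either is renamed, restated or re-cut (R19.862: «NO re-cut of v42.1»).  Hub-small: seven one-line theorems, no `def`.

## What is here

* `rung2aSheaf_upToScale_of_rung2aSheafUpToScale : Rung2aSheafUpToScale I h → ∀ C, ∃ t ≠ 0, Rung2aSheaf (C.rescale t _) I h` — v42.1's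
  scale-covariant door-S shape (POSITIVE shell, `Rung2aSheaf₀`) gives the v41-named up-to-scale form of R19.862 (C′) (`rung2aSheaf_of_rung2aSheaf₀`
  under the binders; `Dsh.Positive` is dropped — it prices the kill path, not the composition).
* `sheafSeedGaussSq_of_rung2aSheafUpToScale_four : Rung2aSheafUpToScale {4} 14 → SheafSeedGaussSq` — THE BRIDGE.  With it the sheaf-door seat
  may register the on-path stub under the v42.1 NAME, `theorem stub_rung2aSheaf : SplitBlock.Rung2aSheafUpToScale {4} 14 := by sorry`, and conclude
  `theorem SheafSeedGaussSq_of := sheafSeedGaussSq_of_rung2aSheafUpToScale_four stub_rung2aSheaf` in ONE line (R19.862 (C′): «prefer the v42.1 name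
  if the bridge is in tree, else the v41 form; either is of record»).  `sheafSeedGaussSq_of_rung2aSheafUpToScale` is the same at any window ∕ height
  (through sheaf8's `sheafSeedGaussSq_of_rung2aSheaf_upToScale`: re-windowing to `{1..8}` is free, rescaling is a THEOREM
  `hasHyperbolicBFSheafSeedOn_rescale_iff` — hence NO `stub_transfer`).
* `not_rung2aSheafUpToScale_of_rung2bSheaf₀With` ∕ `…_of_sPlus₀` ∕ `…_of_sPlus₀_orbit` — THE KILL PATH IN THE SAME CURRENCY: the scope-guarded
  law-free sheaf 2b₀ `Rung2bSheaf₀With C I h Rows` for EVERY theory `C` (the rows read the C-free shadow `δ.Dsh.shadow`, so a pen 2b is uniform in `C`;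
  the `_orbit` form asks it only along the rescalings of the witness) together with rows closed on the scope (`SPlus₀ RD PP h σ π` — a HYPOTHESIS:
  shells 1–2 closed, 3–4 OPEN, R19.853) refutes the up-to-scale stub, GIVEN ONE THEORY `C₀ : ChernCharacterBetti`.  The negation of a `∀ C` statement
  needs a witness: that binder is item 19780 (`Ring2.SemiregularRepresentatives.ChernCharacterOnBetti`, `Nonempty ChernCharacterBetti`) NAMED, never
  assumed — `Lines/sheafdoor.md` must book the kill path against it.  A closed room retires PRESENTATIONS (the positive split-block ansatz at that
  height in that row currency) — never `¬ SheafSeedGaussSq` (officer AUDIT 125 (d)).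
* `rung2aSheafUpToScale_window` ∕ `not_rung2aSheafUpToScale_empty` — SANITY (vacuity guard, J's reading card R-5 shape): given one theory the stub
  forces the window clauses `4 ∈ I` and `∀ p ∈ I, p ≤ 8` of `PassesSheaf` (they do not mention `C`, so they survive the `∀ C ∃ t` binders); in
  particular `¬ Rung2aSheafUpToScale ∅ h`.  Over an EMPTY `ChernCharacterBetti` the stub (like `SheafSeedGaussSq` itself) is vacuously true — the
  standing 19780 caveat, unchanged by this file.

COSTUME (officer AUDIT 123 ∕ AUDIT 125, adopted by director R19.864 (B″)(C″) — cited, not re-derived): read through `_of`, the v42.1-named stub says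
‹for every theory `C`, after some rescaling `chᵢ ↦ tⁱ·chᵢ`, on some CM anchor some in-scope split-block presentation
`0 → ⊕ L_P^{m_P} → ⊕ L_N^{m_N} → 𝓔 → 0` with POSITIVE shell has an `I`-semiregular finite-locally-free COKERNEL `𝓔 = S.X₃` whose Chern character
through the rescaled `C` is the clean rank-free shell design's›; downstream only the anchor, `Dsh`, `K`, the object `S.X₃` and `PassesSheaf` are
consumed (`Dsh.Positive`, `ScopeRows` are not).  How `C` enters `PassesSheaf` on the C-FREE core (sheaf8-1 g9's residual question): only through a
realisation of the letters — `SplitBlockCore₀.PassesSheafVia C hR I := (δ.toSplitBlockCore C hR).PassesSheaf I` with `hR : δ.LettersRealise C`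
(v42.1 §42.2; `rung2aSheaf₀_of_passesSheafVia`): door S is C-carrying by construction (the rank-free checker reads `ch` THROUGH a theory,
`Design.SheafSeedCheckRankFree D C I K 𝓔`), hence the `∀ C ∃ t` shape rather than a C-free one as on the lci door (`Rung2a₀`).

HONEST STATUS.  Wiring: implications over typed structures nobody has inhabited.  Typed ≠ proved; registered ≠ closed; letters ≠ sheaves ≠ SEED.
NOTHING here is proved toward HC ∕ HC_CM ∕ HC_AV ∕ №4 ∕ 26512 ∕ 18881 ∕ 18880 ∕ 27388 ∕ 30548 ∕ 19780 ∕ H2; `stub_rung_pad4_seedAt` and `Lines/*`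
untouched.  No `sorry`, no new axiom, no `def`, no `instance`, no notation.
-/

set_option linter.dupNamespace false
set_option autoImplicit false

open CategoryTheory AlgebraicGeometry
open Literature.AlgebraicGeometry Literature.AlgebraicGeometry.Motives Literature.AlgebraicGeometry.HodgeTheory
open Literature.AlgebraicTopology.SingularHomology

noncomputable section

namespace Summit.HodgeConjecture.HodgeConjecture.Cruxes.BlochSeedDiscOne.SeedChecker

open Summit.HodgeConjecture.HodgeConjecture.Cruxes.BlochSeedDiscOne.Anchor
open Summit.Ventures.HSemireg Summit.Ventures.HSemireg.Pad4Tower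

namespace SplitBlock

/-! ## §42.7 The bridge: `Rung2aSheafUpToScale` ⟹ the v41 up-to-scale form ⟹ `SheafSeedGaussSq` BY NAME -/

section SheafBridge

/-- v42.1's scale-covariant door-S shape (positive shell) gives R19.862 (C′)'s v41-named up-to-scale form.
[cite: BuchweitzFlenner2003, §5 (I-semiregular)] [cite: Fulton1998, Example 3.2.3] -/
theorem rung2aSheaf_upToScale_of_rung2aSheafUpToScale {I : Finset ℕ} {h : ℤ} (H : Rung2aSheafUpToScale I h) :
    ∀ C : ChernCharacterBetti, ∃ (t : ℚ) (ht : t ≠ 0), Rung2aSheaf (C.rescale t ht) I h := fun C => by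
  obtain ⟨t, ht, h2⟩ := H C
  exact ⟨t, ht, rung2aSheaf_of_rung2aSheaf₀ h2⟩

/-- **THE BRIDGE (R19.862 (C′)): `SplitBlock.Rung2aSheafUpToScale {4} 14 → SheafSeedGaussSq` BY NAME** — the `_of` of `Lines/sheafdoor.lean`
under the v42.1 name is ONE line.  [cite: BuchweitzFlenner2003, §5 (I-semiregular)] [cite: Fulton1998, Example 3.2.3] -/
theorem sheafSeedGaussSq_of_rung2aSheafUpToScale_four (H : Rung2aSheafUpToScale {4} 14) :
    Summit.HodgeConjecture.HodgeConjecture.Theses.EightfoldTwistedSheafSeeds.SheafSeedGaussSq :=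
  RBDoorChainSheafCrux.sheafSeedGaussSq_of_rung2aSheaf_four_upToScale (rung2aSheaf_upToScale_of_rung2aSheafUpToScale H)

/-- the same at ANY window and height (re-windowing to `{1..8}` free, rescaling a theorem).
[cite: BuchweitzFlenner2003, §5 (I-semiregular)] [cite: Fulton1998, Example 3.2.3] -/
theorem sheafSeedGaussSq_of_rung2aSheafUpToScale {I : Finset ℕ} {h : ℤ} (H : Rung2aSheafUpToScale I h) :
    Summit.HodgeConjecture.HodgeConjecture.Theses.EightfoldTwistedSheafSeeds.SheafSeedGaussSq :=
  RBDoorChainSheafCrux.sheafSeedGaussSq_of_rung2aSheaf_upToScale fun C => by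
    obtain ⟨t, ht, h2⟩ := H C
    exact ⟨t, ht, I, h, rung2aSheaf_of_rung2aSheaf₀ h2⟩

end SheafBridge

/-! ## §42.8 The kill path in the up-to-scale currency (needs ONE theory: item 19780 named as a binder) and a vacuity guard -/

section SheafKillUpToScale

/-- **KILL, up to scale**: law-free scope-guarded sheaf 2b₀ with `Rows` for EVERY theory ∧ rows closed on the scope ⟹ ¬ `Rung2aSheafUpToScale I h`,
given one theory `C₀` (the `∀ C` stub is refuted at the witness).  Retires presentations, never `¬ SheafSeedGaussSq`. -/
theorem not_rung2aSheafUpToScale_of_rung2bSheaf₀With (C₀ : ChernCharacterBetti) {I : Finset ℕ} {h : ℤ}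
    {Rows : DepthBoundA4.Design → Prop} (h2b : ∀ C : ChernCharacterBetti, Rung2bSheaf₀With C I h Rows)
    (hclosed : ∀ D', ScopeRows h D' → Rows D' → False) : ¬ Rung2aSheafUpToScale I h := fun H => by
  obtain ⟨t, ht, h2⟩ := H C₀
  exact not_rung2aSheaf₀_of_rung2bSheaf₀With (h2b _) hclosed h2

/-- in the v42 row currency: `(∀ C, Rung2bSheaf₀With C I h (ShadowRows₀ RD PP σ π)) ∧ SPlus₀ RD PP h σ π ⟹ ¬ Rung2aSheafUpToScale I h` given one
theory (of record for № 3′: `RD := RowAlpha1.RuleDSharp`, `PP := lawPP`, `π := 3136 − SheafDoorWindowBudget.windowBudget I₀`; `SPlus₀` a HYPOTHESIS). -/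
theorem not_rung2aSheafUpToScale_of_sPlus₀ (C₀ : ChernCharacterBetti) {I : Finset ℕ} {h : ℤ} {RD PP : DepthBoundA4.Design → Prop}
    {σ : DepthBoundA4.Design → ℤ} {π : ℤ} (h2b : ∀ C : ChernCharacterBetti, Rung2bSheaf₀With C I h (ShadowRows₀ RD PP σ π))
    (hS : SPlus₀ RD PP h σ π) : ¬ Rung2aSheafUpToScale I h := fun H => by
  obtain ⟨t, ht, h2⟩ := H C₀
  exact not_rung2aSheaf₀_of_sPlus₀ (h2b _) hS h2

/-- the sharper form: 2b₀ is needed only along the RESCALING ORBIT of the witness theory. -/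
theorem not_rung2aSheafUpToScale_of_sPlus₀_orbit (C₀ : ChernCharacterBetti) {I : Finset ℕ} {h : ℤ} {RD PP : DepthBoundA4.Design → Prop}
    {σ : DepthBoundA4.Design → ℤ} {π : ℤ} (h2b : ∀ (t : ℚ) (ht : t ≠ 0), Rung2bSheaf₀With (C₀.rescale t ht) I h (ShadowRows₀ RD PP σ π))
    (hS : SPlus₀ RD PP h σ π) : ¬ Rung2aSheafUpToScale I h := fun H => by
  obtain ⟨t, ht, h2⟩ := H C₀
  exact not_rung2aSheaf₀_of_sPlus₀ (h2b t ht) hS h2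

/-- with the witness as `Nonempty ChernCharacterBetti` (the form item 19780 delivers). -/
theorem not_rung2aSheafUpToScale_of_sPlus₀_of_nonempty (h₀ : Nonempty ChernCharacterBetti) {I : Finset ℕ} {h : ℤ}
    {RD PP : DepthBoundA4.Design → Prop} {σ : DepthBoundA4.Design → ℤ} {π : ℤ}
    (h2b : ∀ C : ChernCharacterBetti, Rung2bSheaf₀With C I h (ShadowRows₀ RD PP σ π)) (hS : SPlus₀ RD PP h σ π) :
    ¬ Rung2aSheafUpToScale I h := by
  obtain ⟨C₀⟩ := h₀
  exact not_rung2aSheafUpToScale_of_sPlus₀ C₀ h2b hS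

/-- SANITY (vacuity guard): given one theory, the up-to-scale stub forces the window clauses of `PassesSheaf` (`4 ∈ I`, `I ⊆ {0..8}`). -/
theorem rung2aSheafUpToScale_window (C₀ : ChernCharacterBetti) {I : Finset ℕ} {h : ℤ} (H : Rung2aSheafUpToScale I h) :
    4 ∈ I ∧ ∀ p ∈ I, p ≤ 8 := by
  obtain ⟨t, ht, E₀, ψ₀, hE, hψ, δ, _, hδ, _⟩ := H C₀
  obtain ⟨_, h4, hI8, _, _⟩ := hδ
  exact ⟨h4, hI8⟩

/-- … so the empty window is refuted outright (given one theory): the stub is not vacuous in `I`. -/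
theorem not_rung2aSheafUpToScale_empty (C₀ : ChernCharacterBetti) (h : ℤ) : ¬ Rung2aSheafUpToScale ∅ h := fun H =>
  (Finset.notMem_empty 4) (rung2aSheafUpToScale_window C₀ H).1

end SheafKillUpToScale

/-! ## Audit: nothing is decided here

Every theorem above is an implication between `Prop`s of v41 ∕ v42.1 ∕ sheaf8's leaves; `SPlus₀`, the 2b₀ statements and the witness theory `C₀`
(item 19780) enter as hypotheses.  No stub of any skeleton is registered or touched. -/

theorem audit_nothing_decided_sheafBridge : True := trivial

end SplitBlock

end Summit.HodgeConjecture.HodgeConjecture.Cruxes.BlochSeedDiscOne.SeedChecker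

end
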